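import Mathlib.NumberTheory.Cyclotomic.Basic
import Literature.NumberTheory.GaloisRepresentations.ModNCyclotomicCharacter
import Literature.NumberTheory.GaloisRepresentations.AbsGaloisOuterConj
import Literature.RepresentationTheory.FiniteGroups.InvariantLineOfFixedVectors
import HarnessLib

/-!
# Mod `p` plane representations with cyclotomic determinant: the image hypotheses of
# Freitas–Le Hung–Siksek 2015, Prop. 1.1 (proofs)

Topic `Literature/NumberTheory/GaloisRepresentations`; a *proofs* file (theorems only). In the
proof of Prop. 1.1 of N. Freitas, B. V. Le Hung, S. Siksek, *Elliptic curves over real quadratic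
fields are modular*, Invent. Math. 201 (2015) [FreitasLeHungSiksek2015], §4.1 (p. 19 of the held
text `paper:arxiv-1310.7088`), the image `G = ρ̄(G_K) ≤ GL₂(𝔽_p)` of the mod `p` representation
of an elliptic curve over a totally real field `K` is shown to satisfy

> (i) `G` is irreducible, and `G ∩ SL₂(𝔽_p)` is absolutely reducible; (ii) `G` odd (in other
> words, there is some element `c ∈ G` with eigenvalues `1` and `-1`); (iii) `det(G) = 𝔽_p^*`.
> Indeed, (i) follows by assumption and Proposition 3.1, (ii) is a consequence of `K` having a
> real embedding, and (iii) follows from `K ∩ ℚ(ζ_p) = ℚ`,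

where Prop. 3.1 (i) is "`ρ̄(G_{K(ζ_p)}) = ρ̄(G_K) ∩ SL₂(𝔽_p)`" because "the determinant of `ρ̄`
is the mod `p` cyclotomic character". This file proves the Galois-theoretic part of these
deductions for ANY framed `ρ : Γ_K → GL₂(𝔽_p)` whose determinant is the tree's mod `p`
cyclotomic character `modPCyclotomicCharacterZMod K p` (`ModPGaloisRep.lean`) — for `ρ̄_{E,p}`
this is the tree's named fact `WeierstrassCurve.det_eq_modPCyclotomicCharacter_of_isTorsionGaloisRep`
(Weil pairing), taken as a hypothesis `hdet` by consumers, never restated here: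

* `mem_range_absGaloisRestrict_of_modPCyclotomicCharacterZMod_eq_one` — `ker χ̄_p ⊆ res(Γ_L)`
  for a model `L` of `K(ζ_p)` (`IsCyclotomicExtension {p} K L`; `res = absGaloisRestrict K L`,
  whose range is the stabiliser of the embedded copy of `L`,
  `mem_range_absGaloisRestrict_iff_smul_absEmbedding`): the inclusion of Prop. 3.1 (i) that is
  used;
* `exists_eigenvector_of_det_eq_one_of_not_isAbsolutelyIrreducible_restrictField` — (i), second
  half, on vectors: if `ρ|_{Γ_L}` is not absolutely irreducible then, after a base change
  `f : 𝔽_p → B`, some `v ≠ 0` is an eigenvector of every `f(ρ(σ))` with `det ρ(σ) = 1`;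
* `exists_mul_self_eq_one_and_det_eq_neg_one_of_det_eq` — (ii): a real embedding of `K` gives
  `c ∈ Γ_K` with `ρ(c)² = 1`, `det ρ(c) = -1` (complex conjugation, `χ̄_p(c) = -1`);
* the vector-level dictionary for (i), first half: `FramedRep.exists_mulVec_ne_smul_of_isIrreducible`
  (irreducible ⇒ no common eigenvector over the base field) and
  `FramedRep.exists_eigenvector_of_not_isAbsolutelyIrreducible` (not absolutely irreducible ⇒ a
  common eigenvector after a base change), for framed plane representations of any group.

(iii) is `hdet` composed with the surjectivity of `χ̄_p`
(`ModPCyclotomicCharacterTotallyRealProofs.lean`). The group theory of Prop. 1.1 (subgroups of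
`GL₂(𝔽_p)` with (i)–(iii), `p = 3, 5, 7`) is elsewhere.

## References

* [FreitasLeHungSiksek2015] Invent. Math. 201 (2015) 159–206, §2.3 Prop. 3.1 (i) and §4.1
  Prop. 1.1 (proof) — held `paper:arxiv-1310.7088`, pp. 10 and 19 of the text.
-/

noncomputable section

open scoped NumberField IntermediateField
open Field NumberField Module Matrix

namespace Literature.NumberTheory.GaloisRepresentations

universe u v

/-! ### Reducibility over the base field and after base change, on vectors -/

section Lines

variable {G : Type u} [Group G] [TopologicalSpace G] {A : Type v} [Field A] [TopologicalSpace A]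

/-- A framed plane representation which is **not absolutely irreducible** has, after some base
change `f : A →+* B` to a field, a common eigenvector: a non-zero `v ∈ B²` with
`f(ρ(g)) v ∈ B v` for all `g` (an invariant line `L ⊂ B²` of the base change is spanned by any of
its non-zero vectors). [folklore] -/
theorem FramedRep.exists_eigenvector_of_not_isAbsolutelyIrreducible (ρ : FramedRep G A 2)
    (h : ¬ ρ.IsAbsolutelyIrreducible) :
    ∃ (B : Type v) (_ : Field B) (f : A →+* B) (v : Fin 2 → B), v ≠ 0 ∧
      ∀ g : G, ∃ a : B, (((ρ g : GL (Fin 2) A) : Matrix (Fin 2) (Fin 2) A).map f) *ᵥ v = a • v := by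
  classical
  unfold FramedRep.IsAbsolutelyIrreducible at h
  push Not at h
  obtain ⟨B, _, f, hB⟩ := h
  refine ⟨B, inferInstance, f, ?_⟩
  set ρB := ρ.baseChangeRepresentation f with hρB
  have hρBapply : ∀ (g : G) (x : Fin 2 → B),
      ρB g x = (((ρ g : GL (Fin 2) A) : Matrix (Fin 2) (Fin 2) A).map f) *ᵥ x := fun g x ↦ rfl
  -- a subrepresentation `W ≠ ⊥, ⊤`
  have h2F : finrank B (Fin 2 → B) = 2 := Module.finrank_fin_fun B
  have hbt : (⊥ : Subrepresentation ρB) ≠ ⊤ := by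
    intro h
    have h' : (⊥ : Submodule B (Fin 2 → B)) = ⊤ := congrArg Subrepresentation.toSubmodule h
    exact bot_ne_top h'
  obtain ⟨W, hWb, hWt⟩ : ∃ W : Subrepresentation ρB, W ≠ ⊥ ∧ W ≠ ⊤ := by
    by_contra hW
    push Not at hW
    haveI : Nontrivial (Subrepresentation ρB) := ⟨⟨⊥, ⊤, hbt⟩⟩
    exact hB ⟨fun W ↦ (em (W = ⊥)).imp_right (hW W)⟩
  set L : Submodule B (Fin 2 → B) := W.toSubmodule with hL
  have hLbot : L ≠ ⊥ := fun h ↦ hWb (Subrepresentation.toSubmodule_injective h)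
  have hLtop : L ≠ ⊤ := fun h ↦ hWt (Subrepresentation.toSubmodule_injective h)
  have hL1 : finrank B L = 1 :=
    Literature.RepresentationTheory.FiniteGroups.Representation.finrank_eq_one_of_ne_bot_of_ne_top
      h2F hLbot hLtop
  -- `L = B v`
  obtain ⟨v, hvL, hv0⟩ : ∃ v ∈ L, v ≠ 0 := Submodule.exists_mem_ne_zero_of_ne_bot hLbot
  have hLeq : Submodule.span B {v} = L :=
    Literature.RepresentationTheory.FiniteGroups.Representation.eq_of_finrank_eq_one_of_mem
      (finrank_span_singleton hv0) hL1 hv0 (Submodule.mem_span_singleton_self _) hvL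
  refine ⟨v, hv0, fun g ↦ ?_⟩
  have hmem : (((ρ g : GL (Fin 2) A) : Matrix (Fin 2) (Fin 2) A).map f) *ᵥ v ∈
      Submodule.span B {v} := by
    rw [hLeq, ← hρBapply]
    exact W.apply_mem_toSubmodule g hvL
  obtain ⟨a, ha⟩ := Submodule.mem_span_singleton.mp hmem
  exact ⟨a, ha.symm⟩

/-- An **irreducible** framed plane representation has no common eigenvector over the base
field: for every non-zero `v ∈ A²` some `ρ(g)` moves the line `A v`. [folklore] -/
theorem FramedRep.exists_mulVec_ne_smul_of_isIrreducible (ρ : FramedRep G A 2)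
    (h : ρ.IsIrreducible) {v : Fin 2 → A} (hv : v ≠ 0) :
    ∃ g : G, ∀ a : A, ((ρ g : GL (Fin 2) A) : Matrix (Fin 2) (Fin 2) A) *ᵥ v ≠ a • v := by
  by_contra hall
  push Not at hall
  let S : Subrepresentation ρ.toRepresentation :=
    { toSubmodule := Submodule.span A {v}
      apply_mem_toSubmodule := fun g y hy ↦ by
        obtain ⟨b, rfl⟩ := Submodule.mem_span_singleton.mp hy
        obtain ⟨a, ha⟩ := hall g
        rw [map_smul, FramedRep.toRepresentation_apply_apply, ha, smul_smul]
        exact Submodule.mem_span_singleton.mpr ⟨b * a, rfl⟩ }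
  have h2A : finrank A (Fin 2 → A) = 2 := Module.finrank_fin_fun A
  have hS := Literature.RepresentationTheory.FiniteGroups.Representation.ne_bot_and_ne_top_of_finrank_eq_one
    h2A (finrank_span_singleton hv)
  rcases h.eq_bot_or_eq_top S with h | h
  · exact hS.1 (congrArg Subrepresentation.toSubmodule h)
  · exact hS.2 (congrArg Subrepresentation.toSubmodule h)

end Lines

/-! ### `Γ_{K(ζ_p)} ⊇ ker χ̄_p` -/

section Cyclotomic

variable (K : Type u) [Field K] [CharZero K] (p : ℕ) [Fact p.Prime]

/-- For a model `L` of `K(ζ_p)` (`IsCyclotomicExtension {p} K L`), every `σ ∈ Γ_K` with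
`χ̄_p(σ) = 1` is a restriction from `Γ_L` (along the tree's `absGaloisRestrict K L`, whose range
is the pointwise stabiliser of the embedded copy `e(L) ⊆ K̄`,
`mem_range_absGaloisRestrict_iff_smul_absEmbedding`): `σ` fixes every `p`-th root of unity of
`K̄` (`modPCyclotomicCharacterZMod_spec`), and `e(L)` is generated over `K` by such roots
(`IsCyclotomicExtension.adjoin_roots`). This is the inclusion "`⊇`" of Freitas–Le Hung–Siksek
2015, Prop. 3.1 (i), `ρ̄(G_{K(ζ_p)}) = ρ̄(G_K) ∩ SL₂(𝔽_p)`, before composing with a `ρ̄` of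
cyclotomic determinant. [cite: FreitasLeHungSiksek2015, Prop. 3.1 (i)] -/
theorem mem_range_absGaloisRestrict_of_modPCyclotomicCharacterZMod_eq_one
    (L : Type v) [Field L] [Algebra K L] [IsCyclotomicExtension {p} K L]
    {σ : absoluteGaloisGroup K} (hσ : modPCyclotomicCharacterZMod K p σ = 1) :
    σ ∈ (absGaloisRestrict K L).range := by
  haveI : NeZero (p : K) := NeZero.charZero
  haveI : Module.Finite K L := IsCyclotomicExtension.finite {p} K L
  haveI : Algebra.IsAlgebraic K L := Algebra.IsAlgebraic.of_finite K L
  rw [mem_range_absGaloisRestrict_iff_smul_absEmbedding]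
  intro x
  induction IsCyclotomicExtension.adjoin_roots (S := {p}) (A := K) (B := L) x using
    Algebra.adjoin_induction with
  | mem b hb =>
    obtain ⟨n, hn, -, hbn⟩ := hb
    rw [Set.mem_singleton_iff] at hn
    subst hn
    have hb' : (absEmbedding K L b) ^ n = 1 := by rw [← map_pow, hbn, map_one]
    rw [modPCyclotomicCharacterZMod_spec K n σ _ hb', hσ, Units.val_one,
      ZMod.val_one'' (Fact.out : n.Prime).one_lt.ne', pow_one]
  | algebraMap r =>
    rw [AlgHom.commutes, absoluteGaloisGroup.smul_def, AlgEquiv.commutes]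
  | add y z _ _ hy hz => rw [map_add, smul_add, hy, hz]
  | mul y z _ _ hy hz => rw [map_mul, smul_mul', hy, hz]

end Cyclotomic

/-! ### Plane representations with cyclotomic determinant -/

section CyclotomicDet

variable {K : Type u} [Field K] [CharZero K] {p : ℕ} [Fact p.Prime]

omit [CharZero K] in
/-- **Oddness, on matrices.** If `det ρ = χ̄_p` and `K` has a real embedding `φ`, then the
image of `ρ : Γ_K → GL₂(𝔽_p)` contains an involution of determinant `-1`, namely `ρ(c)` for a
complex conjugation `c` (`exists_isComplexConjugation`, `IsComplexConjugation.sq_eq_one`,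
`χ̄_p(c) = -1`: `modNCyclotomicCharacter_of_isComplexConjugation`) — hypothesis (ii) "`G` odd" in
the proof of Freitas–Le Hung–Siksek 2015, Prop. 1.1 ("a consequence of `K` having a real
embedding"). [cite: FreitasLeHungSiksek2015, Prop. 1.1 (proof, (ii))] -/
theorem exists_mul_self_eq_one_and_det_eq_neg_one_of_det_eq [NeZero (p : K)] {n : ℕ}
    (ρ : FramedGaloisRep K (ZMod p) n)
    (hdet : ∀ σ, Matrix.GeneralLinearGroup.det (ρ σ) = modPCyclotomicCharacterZMod K p σ)
    (φ : K →+* ℝ) :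
    ∃ c : absoluteGaloisGroup K, ρ c * ρ c = 1 ∧ Matrix.GeneralLinearGroup.det (ρ c) = -1 := by
  obtain ⟨c, hc⟩ := exists_isComplexConjugation φ
  refine ⟨c, ?_, ?_⟩
  · rw [← map_mul, ← sq, hc.sq_eq_one, map_one]
  · rw [hdet, modPCyclotomicCharacterZMod_eq_modNCyclotomicCharacter]
    exact Units.ext (by
      rw [Units.val_neg, Units.val_one]
      exact modNCyclotomicCharacter_of_isComplexConjugation hc)

/-- **`ρ̄(G_{K(ζ_p)}) ⊇ ρ̄(G_K) ∩ SL₂(𝔽_p)` on vectors.** If `det ρ = χ̄_p` and the restriction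
of `ρ : Γ_K → GL₂(𝔽_p)` to `Γ_L`, `L` a model of `K(ζ_p)`, is not absolutely irreducible, then
after some base change `f : 𝔽_p →+* B` there is a non-zero `v ∈ B²` which is an eigenvector of
`f(ρ(σ))` for every `σ ∈ Γ_K` with `det ρ(σ) = 1` (such `σ` are restrictions from `Γ_L`,
`mem_range_absGaloisRestrict_of_modPCyclotomicCharacterZMod_eq_one`) — the form of hypothesis
(i) "`G ∩ SL₂(𝔽_p)` is absolutely reducible" in the proof of Freitas–Le Hung–Siksek 2015,
Prop. 1.1, via their Prop. 3.1 (i). [cite: FreitasLeHungSiksek2015, Prop. 3.1 (i)] -/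
theorem exists_eigenvector_of_det_eq_one_of_not_isAbsolutelyIrreducible_restrictField
    (ρ : FramedGaloisRep K (ZMod p) 2)
    (hdet : ∀ σ, Matrix.GeneralLinearGroup.det (ρ σ) = modPCyclotomicCharacterZMod K p σ)
    (L : Type v) [Field L] [Algebra K L] [IsCyclotomicExtension {p} K L]
    (h : ¬ FramedRep.IsAbsolutelyIrreducible (ρ.restrictField L)) :
    ∃ (B : Type) (_ : Field B) (f : ZMod p →+* B) (v : Fin 2 → B), v ≠ 0 ∧
      ∀ σ : absoluteGaloisGroup K, Matrix.GeneralLinearGroup.det (ρ σ) = 1 →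
        ∃ a : B, (((ρ σ : GL (Fin 2) (ZMod p)) : Matrix (Fin 2) (Fin 2) (ZMod p)).map f) *ᵥ v =
          a • v := by
  obtain ⟨B, _, f, v, hv, hB⟩ :=
    FramedRep.exists_eigenvector_of_not_isAbsolutelyIrreducible (ρ.restrictField L) h
  refine ⟨B, inferInstance, f, v, hv, fun σ hσ ↦ ?_⟩
  have hχ : modPCyclotomicCharacterZMod K p σ = 1 := by rw [← hdet, hσ]
  obtain ⟨τ, rfl⟩ := mem_range_absGaloisRestrict_of_modPCyclotomicCharacterZMod_eq_one K p L hχ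
  exact hB τ

end CyclotomicDet

end Literature.NumberTheory.GaloisRepresentations

end
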